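import Literature.Barriers.Schanuel.NesterenkoModularScopePlaceExpansion
import Literature.NumberTheory.DiophantineGeometry.FunctionFieldGenusEllZeroProofs
import Literature.NumberTheory.DiophantineGeometry.FunctionFieldGenusProofs
import Mathlib.RingTheory.Valuation.LocalSubring
import Mathlib.FieldTheory.IsAlgClosed.Basic
import HarnessLib

/-!
# Barrier (Schanuel) `NesterenkoModularScope`: a branch of a curve at a point, as a power-series embedding — proofs only

`Literature/Barriers/Schanuel/NesterenkoModularScopePlaceCentred.lean` — proofs-only groundwork
(no definitions, nothing asserted) for LNM 1752 Ch. 10 Proposition 5.1 (named fact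
`NesterenkoPhilippon2001_ch10_prop_5_1`). The printed proof of Lemma 5.3 (p. 163) parametrizes a
branch at `x = 1` of the algebraic functions `u(x), v(x)` ("`x = 1 + tᵉ, u = Σ aₖtᵏ, v = Σ bₖtᵏ`").
Here this is supplied, over an algebraically closed constant field `K`, for any subring `A` of an
algebraic function field of one variable `F/K` (tree: `IsAlgFunctionField`,
`Literature/NumberTheory/DiophantineGeometry/FunctionFieldGenus.lean`) and any proper non-zero
ideal `I` of `A` (the point):

* `exists_ringHom_powerSeries_centred` — there is an injective ring homomorphism
  `ι : A → K⟦t⟧` with `ι(I) ⊆ (t)` and `ι(c) = c` for constants `c ∈ K`.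

Proof: Chevalley's extension theorem in Mathlib's form
`Ideal.image_subset_nonunits_valuationSubring` (= Stichtenoth Thm. 1.1.19: a valuation ring
`𝒪 ⊇ A` of `F` whose maximal ideal contains `I`); `𝒪 ≠ F` since `I ≠ 0`; `𝒪` is a discrete
valuation ring by Stichtenoth Thm. 1.1.6 (`IsAlgFunctionField.isDiscreteValuationRing_of_ne_top_holds`);
its residue field is finite over `K` (Stichtenoth Prop. 1.1.15,
`PlaceOver.finiteDimensional_residueField_holds`), hence equal to `K` (`K` algebraically closed);
and a DVR with coefficient field `K` expands into `K⟦t⟧` (`exists_algHom_powerSeries_of_residue`,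
`NesterenkoModularScopePlaceExpansion.lean`).

## References

* [Stichtenoth2009] H. Stichtenoth, *Algebraic Function Fields and Codes*, GTM 254: Thm. 1.1.6,
  Prop. 1.1.15, Thm. 1.1.19, Thm. 4.2.6.
* [NesterenkoPhilippon2001] LNM 1752, Ch. 10 §5, proof of Lemma 5.3 (p. 163) and of Prop. 5.1
  (p. 166).
-/

noncomputable section

open PowerSeries IsLocalRing
open Literature.NumberTheory.DiophantineGeometry

namespace Literature.Barriers.Schanuel

/-- **A branch centred at a point, as an embedding into power series.** Let `F/K` be an algebraic
function field of one variable over an algebraically closed field `K`, `A ⊆ F` a subring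
containing `K`, and `I` a proper non-zero ideal of `A`. Then there is an injective ring
homomorphism `ι : A → K⟦t⟧`, the identity on constants, with `ι(I) ⊆ (t)`.
[cite: Stichtenoth2009, Thm. 1.1.19, Thm. 1.1.6, Prop. 1.1.15, Thm. 4.2.6]
[cite: NesterenkoPhilippon2001, Ch. 10 §5, proof of Lemma 5.3 (p. 163)] -/
theorem exists_ringHom_powerSeries_centred {K F : Type*} [Field K] [IsAlgClosed K] [Field F]
    [Algebra K F] [IsAlgFunctionField K F] (A : Subring F) (hK : ∀ c : K, algebraMap K F c ∈ A)
    (I : Ideal A) (hI : I ≠ ⊤) (hI0 : I ≠ ⊥) :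
    ∃ ι : A →+* K⟦X⟧, Function.Injective ι ∧ (∀ a ∈ I, constantCoeff (ι a) = 0) ∧
      ∀ c : K, ι ⟨algebraMap K F c, hK c⟩ = C c := by
  obtain ⟨V, hAV, hIV⟩ := Ideal.image_subset_nonunits_valuationSubring I hI
  have hKV : ∀ c : K, algebraMap K F c ∈ V := fun c => hAV (hK c)
  -- `V ≠ F`: a non-zero element of `I` is a non-unit of `V`
  have hVtop : V ≠ ⊤ := by
    obtain ⟨a, haI, ha0⟩ := I.ne_bot_iff.mp hI0
    have hanu : (a : F) ∈ V.nonunits := hIV ⟨a, haI, rfl⟩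
    have ha0' : (a : F) ≠ 0 := fun h => ha0 (Subtype.ext h)
    have h := (V.inv_mem_nonunits_iff (x := (a : F)⁻¹)).mp (by rwa [inv_inv])
    rcases h with h | h
    · exact absurd (inv_eq_zero.mp h) ha0'
    · rintro rfl
      exact h (ValuationSubring.mem_top _)
  haveI hdvr : IsDiscreteValuationRing V :=
    IsAlgFunctionField.isDiscreteValuationRing_of_ne_top_holds V hVtop hKV
  let v : AlgFunctionField.PlaceOver K F := ⟨V, hVtop, hdvr, hKV⟩
  have hv : v.toValuationSubring = V := rfl
  clear_value v
  subst hv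
  -- the residue field of `V` is `K`
  haveI : FiniteDimensional K v.residueField :=
    AlgFunctionField.PlaceOver.finiteDimensional_residueField_holds v
  have hres : ∀ f : v.toValuationSubring, ∃ c : K,
      f - algebraMap K v.toValuationSubring c ∈ maximalIdeal v.toValuationSubring := by
    intro f
    obtain ⟨c, hc⟩ := (IsAlgClosed.algebraMap_bijective_of_isIntegral (k := K)
      (K := v.residueField)).2 (residue v.toValuationSubring f)
    refine ⟨c, ?_⟩
    rw [← residue_eq_zero_iff, map_sub, ← hc, AlgFunctionField.PlaceOver.algebraMap_residueField_apply,
      sub_self]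
  obtain ⟨ι₀, hι₀, hι₀max⟩ := exists_algHom_powerSeries_of_residue (K := K)
    (O := v.toValuationSubring) hres
  -- compose with the inclusion `A ⊆ V`
  refine ⟨ι₀.toRingHom.comp (Subring.inclusion hAV), ?_, ?_, ?_⟩
  · exact hι₀.comp (Subring.inclusion_injective hAV)
  · intro a haI
    have hanu : (a : F) ∈ v.toValuationSubring.nonunits := hIV ⟨a, haI, rfl⟩
    obtain ⟨haV, hmax⟩ := ValuationSubring.mem_nonunits_iff_exists_mem_maximalIdeal.mp hanu
    have e : Subring.inclusion hAV a = ⟨(a : F), haV⟩ := rfl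
    rw [RingHom.comp_apply, e]
    exact hι₀max _ hmax
  · intro c
    have e : Subring.inclusion hAV ⟨algebraMap K F c, hK c⟩ = algebraMap K v.toValuationSubring c :=
      Subtype.ext (by
        rw [AlgFunctionField.PlaceOver.algebraMap_toValuationSubring_apply]; rfl)
    rw [RingHom.comp_apply, e, AlgHom.toRingHom_eq_coe, RingHom.coe_coe, AlgHom.commutes,
      PowerSeries.algebraMap_eq]

end Literature.Barriers.Schanuel

end
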